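import Literature.NumberTheory.LFunctions.WeilTwoPrimeOddMarginHBase
import Literature.NumberTheory.LFunctions.WeilBlockRows
import Literature.NumberTheory.LFunctions.WeilBlockRowsDCFast
import HarnessLib

/-!
# Two-prime odd-margin certificate H: rows 0–3 of the check `D C = I` (odd block)

Part of the odd-block check of `weilCert23H` (`WeilCert.checkDCRow`), row by row, each by `decide +kernel` on the linear-traversal form `WeilCert.checkDCRowF` (`WeilBlockRowsDCFast.lean`, drop-in `WeilCert.checkDCRow_of_F`; the indexed form exceeds the farm's per-`decide` budget at `nb = 128`). Pure proof file; nothing is asserted.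
-/

noncomputable section

namespace Literature.NumberTheory.LFunctions

set_option maxHeartbeats 0 in
/-- Kernel check of row 0 of `D C = I` (certificate H). [folklore] -/
theorem checkDCRow1_0_weilCert23H : weilCert23HBase.checkDCRow 1 0 = true :=
  WeilCert.checkDCRow_of_F (by decide +kernel)

set_option maxHeartbeats 0 in
/-- Kernel check of row 1 of `D C = I` (certificate H). [folklore] -/
theorem checkDCRow1_1_weilCert23H : weilCert23HBase.checkDCRow 1 1 = true :=
  WeilCert.checkDCRow_of_F (by decide +kernel)

set_option maxHeartbeats 0 in
/-- Kernel check of row 2 of `D C = I` (certificate H). [folklore] -/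
theorem checkDCRow1_2_weilCert23H : weilCert23HBase.checkDCRow 1 2 = true :=
  WeilCert.checkDCRow_of_F (by decide +kernel)

set_option maxHeartbeats 0 in
/-- Kernel check of row 3 of `D C = I` (certificate H). [folklore] -/
theorem checkDCRow1_3_weilCert23H : weilCert23HBase.checkDCRow 1 3 = true :=
  WeilCert.checkDCRow_of_F (by decide +kernel)


end Literature.NumberTheory.LFunctions
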